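import Summits.BirchSwinnertonDyer.BirchSwinnertonDyer.Theorems.SignedLowerHalvesSmallImageLowerHalfBothSignsRttD2SeqSemilocUnramified
import Summits.BirchSwinnertonDyer.BirchSwinnertonDyer.Theorems.SignedLowerHalvesSmallImageLowerHalfBothSignsRttD2SeqSemilocLambda
import HarnessLib

/-!
# Route `SignedLowerHalves`, crux L `SmallImageLowerHalfBothSigns` (stmt-BirchSwinnertonDyer-23599), line `rtt_w3` v30 — stub S3β″ (`stub_junctionPT_ns`, row J4′,
# Poitou–Tate half): THE POITOU–TATE HALF ASSEMBLED MODULO THE LOCAL INPUTS — `λ(H′) ≤ λ(Y″) + λ(I.H ⧸ B′)` for the `(S₀ ∖ P)`-unramified semilocal families `H′`,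
# GIVEN only the finiteness/torsion of `Π_{w∈S₀} 𝐇¹_{Iw,w}` (N5-i)

WIDTH seat `bsd-line-slh-p3-w3` g26 under LEAD `cruxlead-stmt-BirchSwinnertonDyer-23599` g14 (cell `bsd-ssimc`); helper `--supports stmt-BirchSwinnertonDyer-23599`
(design memo `Lines/rtt_w3-DESIGN-S3beta-w3-g25.md`, rev 4 §6 "closing formula"). ONE DEFINITION WITH BODY (`phiOn`, the restriction of `Φ` to a `Λ_𝒪`-submodule as a `Λ`-linear map)
+ THEOREMS; no named fact, no instance, no `sorry`. HONEST FRAMING: this is T5 (p812244) ∘ N2 (Φ: p816516, p816550; `hPT` on `H′`: `…SemilocUnramified`); with lambda-p1's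
`strictDual_add_le_coker_add_of_le_locImageDual_add` the LEAD's S3β″ follows AS SOON AS (N5-i) `Π_{w∈S₀} 𝐇¹_{Iw,w}` is shown finitely generated torsion over `Λ` and (N5-iii)
`λ(Λ_𝒪/(E)) ≤ λ(H′)`; both remain OPEN here, as do S3β″, S3α′, crux L and BSD (proved for NO curve).

* `moduleFinite_locImageDual` / `isTorsion_locImageDual` — `Y″ = (Sel_{str,v} ⧸ Sel_{str at Σ})^∨` is finitely generated torsion when `Dψ.X` is (`Y″ ↪ Sel_{str,v}^∨ ↞ Dψ.X`, lambda-p1 `inflLinearMap_injective`,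
  `resAtLinearMap_surjective`).
* `phiOn H′ : H′ →ₗ[Λ] Y″`, `phiOn_apply`.
* ★★★ `lambdaInvariant_unramifiedFamilies_le` — `λ(H′) ≤ λ(Y″) + λ(I.H ⧸ range B′.subtype)` for `H′ = unramifiedFamilies …` (constructed semilocal data, honda orientation `γ⁻¹`), from T5 with
  `Φ := phiOn H′` and `hPT := mem_range_semilocMapPi_of_phiLocImage_eq_zero`, hypotheses: `hfin`/`htors` on `Π (L w).H` (N5-i), the frame data of T4 (`𝓛`, `hvS₀`, `hvP`, `hP`, `hPS₀`, `hpv`, `hNP`, `hperf`).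
References: [Rubin2000] Thm. 1.7.3, App. B.3; [Kobayashi2003] Thm. 7.3 i); [Washington1997] §13.2; [PerrinRiou1994Invent] §1.3; [GreenbergVatsal2000] §2 Prop. (2.4).
-/

set_option autoImplicit false
set_option linter.dupNamespace false -- D-0017: single-problem summit, the namespace repeats the problem name by design
noncomputable section

open scoped Classical
open CategoryTheory Function NumberField IsDedekindDomain Field

namespace Summit.BirchSwinnertonDyer.BirchSwinnertonDyer.Theorems.SmallImageRttD2Seq

open Literature.NumberTheory.GaloisRepresentations Literature.NumberTheory.GaloisCohomology Literature.NumberTheory.EllipticCurves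
  Literature.NumberTheory.EllipticCurves.IwasawaDual Literature.NumberTheory.EllipticCurves.Kobayashi2003
  Literature.NumberTheory.ComplexMultiplication.EllipticUnits Literature.NumberTheory.ComplexMultiplication.EllipticUnits.JohnsonLeungKings2011
  Literature.NumberTheory.GaloisRepresentations.DiscreteGaloisModule
  Summit.BirchSwinnertonDyer.BirchSwinnertonDyer.Theorems.SmallImageRttD2J1 Summit.BirchSwinnertonDyer.BirchSwinnertonDyer.Theorems.SmallImageCharSignedSelmer

/-! ## §1. `Y″` is finitely generated torsion when `Dψ.X` is -/

section Ydd

variable {K : Type} [Field K] [NumberField K] {p : ℕ} [Fact p.Prime] {κ : ZpExtension K p} {γ : absoluteGaloisGroup K}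
  {M : Type} [AddCommGroup M] [DistribMulAction (absoluteGaloisGroup K) M] [TopologicalSpace M] [DiscreteTopology M]
  {R : Type*} [Ring R] [Module R M] {V : WeierstrassCurve K} {j : V.geomPrimaryTorsion p →+ M} {S₀ : Set (HeightOneSpectrum (𝓞 K))} {ε : ℤˣ}
  (D : SignedTransportDualDataSat κ γ M R V j S₀ ε) {v : HeightOneSpectrum (𝓞 K)} [DistribMulAction (absoluteGaloisGroup (v.adicCompletion K)) M]
  (hres : ∀ (σ : absoluteGaloisGroup (v.adicCompletion K)) (m : M), σ • m = resGalOfEmb (closureEmb (K := K) (v.adicCompletion K)) σ • m)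
  (hv : (p : 𝓞 K) ∈ v.asIdeal) (S₁ : Set (HeightOneSpectrum (𝓞 K))) (hns : AcSigned.IsNonsplitIn κ v) (htor : ∀ m : M, ∃ k : ℕ, p ^ k • m = 0)
  (hstabK : ∀ m : M, IsOpen (MulAction.stabilizer (absoluteGaloisGroup K) m : Set (absoluteGaloisGroup K))) (hγ : κ.IsTopGenerator γ)

/-- **`Y″ = (Sel_{str,v} ⧸ Sel_{str at Σ})^∨` is a finitely generated `Λ`-module** when `Dψ.X` is: `Y″ ↪ Sel_{str,v}^∨` (`inflLinearMap_injective`), `Dψ.X ↠ Sel_{str,v}^∨`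
(`resAtLinearMap_surjective`), `Λ` Noetherian. [cite: Washington1997, §13.2] -/
theorem moduleFinite_locImageDual [Module.Finite (IwasawaAlgebra p) D.X] :
    letI := locImageDualModule κ R V j S₀ ε v hres hv S₁ hns htor hstabK hγ
    Module.Finite (IwasawaAlgebra p) (locImageQuot κ M R V j S₀ ε v hres hv S₁ →+ AddCircle (1 : ℚ)) := by
  letI := locImageDualModule κ R V j S₀ ε v hres hv S₁ hns htor hstabK hγ
  letI := strictAtDualModule κ R V j S₀ ε v hres hv hns htor hstabK hγ
  haveI : Module.Finite (IwasawaAlgebra p) (strictAt κ M R V j S₀ ε v hres hv →+ AddCircle (1 : ℚ)) :=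
    Module.Finite.of_surjective (resAtLinearMap D hres hv hns htor hstabK hγ) (resAtLinearMap_surjective D hres hv hns htor hstabK hγ)
  haveI : IsNoetherian (IwasawaAlgebra p) (strictAt κ M R V j S₀ ε v hres hv →+ AddCircle (1 : ℚ)) := isNoetherian_of_isNoetherianRing_of_finite _ _
  exact Module.Finite.of_injective (inflLinearMap hres hv S₁ hns htor hstabK hγ) (inflLinearMap_injective hres hv S₁ hns htor hstabK hγ)

/-- **`Y″` is `Λ`-torsion** when `Dψ.X` is (same two maps). [cite: Washington1997, §13.2] -/
theorem isTorsion_locImageDual (hX : Module.IsTorsion (IwasawaAlgebra p) D.X) :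
    letI := locImageDualModule κ R V j S₀ ε v hres hv S₁ hns htor hstabK hγ
    Module.IsTorsion (IwasawaAlgebra p) (locImageQuot κ M R V j S₀ ε v hres hv S₁ →+ AddCircle (1 : ℚ)) := by
  letI := locImageDualModule κ R V j S₀ ε v hres hv S₁ hns htor hstabK hγ
  letI := strictAtDualModule κ R V j S₀ ε v hres hv hns htor hstabK hγ
  intro y
  obtain ⟨x, hx⟩ := resAtLinearMap_surjective D hres hv hns htor hstabK hγ (inflLinearMap hres hv S₁ hns htor hstabK hγ y)
  obtain ⟨a, ha⟩ := @hX x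
  refine ⟨a, inflLinearMap_injective hres hv S₁ hns htor hstabK hγ ?_⟩
  change inflLinearMap hres hv S₁ hns htor hstabK hγ ((a : IwasawaAlgebra p) • y) = inflLinearMap hres hv S₁ hns htor hstabK hγ 0
  rw [map_smul, map_zero, ← hx, ← map_smul, show (a : IwasawaAlgebra p) • x = 0 from ha, map_zero]

end Ydd

/-! ## §2. `Φ` on a submodule and the assembled Poitou–Tate half -/

section Assembly

variable {K : Type} [Field K] [NumberField K] {p : ℕ} [Fact p.Prime] (S : Set (PadicAlgCl p)) [FiniteDimensional ℚ_[p] (padicCoeffField S)] (κ : ZpExtension K p)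
  (γ : absoluteGaloisGroup K) (θ' : absoluteGaloisGroup K →ₜ* (padicCoeffIntegers S)ˣ) (P : Set (HeightOneSpectrum (𝓞 K))) (v : HeightOneSpectrum (𝓞 K))
  (M : Type) [AddCommGroup M] [TopologicalSpace M] [DiscreteTopology M] [DistribMulAction (absoluteGaloisGroup K) M]
  [Module (padicCoeffIntegers S) M] [SMulCommClass (absoluteGaloisGroup K) (padicCoeffIntegers S) M]
  (hstabK : ∀ m : M, IsOpen (MulAction.stabilizer (absoluteGaloisGroup K) m : Set (absoluteGaloisGroup K)))
  (PG : ∀ k : ℕ, ContPairing (coeffRepK S θ' P k).toTopRep (torsRep M hstabK p k).toTopRep (mu K (p ^ k)).toTopRep)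
  (hPred : ∀ (k : ℕ) (x : ↥(Representation.invariants ((muTwistO S θ' (k + 1)).toRepresentation.comp (ramificationSubgroup K P).subtype))) (m : ↥(torsionPow M p k)),
    (PG (k + 1)).toLin x (AddSubgroup.inclusion (torsionPow_mono (M := M) (p := p) (Nat.le_succ k)) m) =
      muInclusion K (pow_dvd_pow p (Nat.le_succ k)) ((PG k).toLin (coeffMapO S P θ' (oMuRed S k) (oMuRed_muTwistO S θ' k) x) m))
  (hPsc : ∀ (k : ℕ) (a : padicCoeffIntegers S) (x : ↥(Representation.invariants ((muTwistO S θ' k).toRepresentation.comp (ramificationSubgroup K P).subtype)))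
    (m : ↥(torsionPow M p k)), (PG k).toLin (coeffMapO S P θ' (oMuScalar S (p ^ k) a) (oMuScalar_muTwistO S θ' k a) x) m = (PG k).toLin x (a • m))
  (hM : ∀ m : M, ∃ k : ℕ, p ^ k • m = 0)
  (V : WeierstrassCurve K) (j : V.geomPrimaryTorsion p →+ M) (S₀ : Set (HeightOneSpectrum (𝓞 K))) (hS₀ : S₀.Finite) (ε : ℤˣ)
  (hvp : ((p : ℕ) : 𝓞 K) ∈ v.asIdeal) (hpv : ∀ w : HeightOneSpectrum (𝓞 K), ((p : ℕ) : 𝓞 K) ∈ w.asIdeal → w = v) (hns : AcSigned.IsNonsplitIn κ v) (hγ : κ.IsTopGenerator γ)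
  (S₁ : Set (HeightOneSpectrum (𝓞 K))) (hS₀S₁ : S₀ ⊆ S₁)

/-- **`Φ` restricted to a `Λ_𝒪`-submodule `H′ ≤ Π_{w∈S₀} 𝐇¹_{Iw,w}`, as a `Λ`-linear map `H′ → Y″`** (scalar towers `Λ → Λ_𝒪`). [cite: Rubin2000, Thm. 1.7.3] -/
def phiOn (H' : Submodule (IwasawaAlgebraO S) (∀ w : S₀, (semilocIwasawaCohomologyDataO S κ γ⁻¹ θ' P w 1).H)) :
    letI := localAction (closureEmb (K := K) (v.adicCompletion K)) M
    letI : ∀ w : HeightOneSpectrum (𝓞 K), Module (IwasawaAlgebra p) (semilocIwasawaCohomologyDataO S κ γ⁻¹ θ' P w 1).H :=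
      fun w ↦ (semilocIwasawaCohomologyDataO S κ γ⁻¹ θ' P w 1).moduleIwasawa
    letI : Algebra (IwasawaAlgebra p) (IwasawaAlgebraO S) := (iwasawaToIwasawaO S).toAlgebra
    haveI : ∀ w : HeightOneSpectrum (𝓞 K), IsScalarTower (IwasawaAlgebra p) (IwasawaAlgebraO S) (semilocIwasawaCohomologyDataO S κ γ⁻¹ θ' P w 1).H :=
      fun w ↦ (semilocIwasawaCohomologyDataO S κ γ⁻¹ θ' P w 1).isScalarTower_moduleIwasawa
    letI := locImageDualModule κ (padicCoeffIntegers S) V j S₀ ε v (fun _ _ ↦ rfl) hvp S₁ hns hM hstabK hγ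
    H' →ₗ[IwasawaAlgebra p] (locImageQuot κ M (padicCoeffIntegers S) V j S₀ ε v (fun _ _ ↦ rfl) hvp S₁ →+ AddCircle (1 : ℚ)) :=
  letI := localAction (closureEmb (K := K) (v.adicCompletion K)) M
  letI : ∀ w : HeightOneSpectrum (𝓞 K), Module (IwasawaAlgebra p) (semilocIwasawaCohomologyDataO S κ γ⁻¹ θ' P w 1).H :=
    fun w ↦ (semilocIwasawaCohomologyDataO S κ γ⁻¹ θ' P w 1).moduleIwasawa
  letI : Algebra (IwasawaAlgebra p) (IwasawaAlgebraO S) := (iwasawaToIwasawaO S).toAlgebra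
  haveI : ∀ w : HeightOneSpectrum (𝓞 K), IsScalarTower (IwasawaAlgebra p) (IwasawaAlgebraO S) (semilocIwasawaCohomologyDataO S κ γ⁻¹ θ' P w 1).H :=
    fun w ↦ (semilocIwasawaCohomologyDataO S κ γ⁻¹ θ' P w 1).isScalarTower_moduleIwasawa
  letI := locImageDualModule κ (padicCoeffIntegers S) V j S₀ ε v (fun _ _ ↦ rfl) hvp S₁ hns hM hstabK hγ
  (phiLinearMap S κ γ θ' P M hstabK PG hPred hM V j S₀ hS₀ ε v (fun _ _ ↦ rfl) hvp (fun w ↦ semilocIwasawaCohomologyDataO S κ γ⁻¹ θ' P w 1) S₁ hS₀S₁ hPsc hns hγ).comp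
    (H'.subtype.restrictScalars (IwasawaAlgebra p))

/-- Values of `phiOn`: `Φ` of the underlying family. [folklore] -/
theorem phiOn_apply (H' : Submodule (IwasawaAlgebraO S) (∀ w : S₀, (semilocIwasawaCohomologyDataO S κ γ⁻¹ θ' P w 1).H)) (x : H') :
    phiOn S κ γ θ' P v M hstabK PG hPred hPsc hM V j S₀ hS₀ ε hvp hns hγ S₁ hS₀S₁ H' x =
      (letI := localAction (closureEmb (K := K) (v.adicCompletion K)) M
       phiLocImage S κ γ θ' P M hstabK PG hPred hM V j S₀ hS₀ ε v (fun _ _ ↦ rfl) hvp (fun w ↦ semilocIwasawaCohomologyDataO S κ γ⁻¹ θ' P w 1) S₁ hS₀S₁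
        (x : ∀ w : S₀, (semilocIwasawaCohomologyDataO S κ γ⁻¹ θ' P w 1).H)) :=
  rfl

include hpv hPred hPsc hS₀ hS₀S₁ in
/-- ★★★ **THE POITOU–TATE HALF OF S3β″ ASSEMBLED MODULO THE LOCAL INPUTS**: for honda's `I` (orientation `γ⁻¹`), the constructed semilocal data `L w`, `B′ = strictCarrier I (strictLevel … S₀)` and
`H′ = unramifiedFamilies …` (the `(S₀ ∖ P)`-unramified families): IF `Π_{w∈S₀} (L w).H` is finitely generated torsion over `Λ` (N5-i) and `Dψ.X` is (prefix), THEN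
`λ(H′) ≤ λ(Y″) + λ(I.H ⧸ range B′.subtype)` — T5 `lambdaInvariant_le_add_of_ker_subset_range_semilocMapPi` (p812244) with `Φ := phiOn H′` (N2) and `hPT` from T4 via N2d (γ)
(`mem_range_semilocMapPi_of_phiLocImage_eq_zero`). S3β″ = this + the local count `λ(Λ_𝒪/(E)) ≤ λ(H′)` (N5-iii). [cite: Rubin2000, Thm. 1.7.3, App. B.3] [cite: Kobayashi2003, Thm. 7.3 i)]
[cite: PerrinRiou1994Invent, §1.3] [cite: Washington1997, §13.2] -/
theorem lambdaInvariant_unramifiedFamilies_le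
    (D : SignedTransportDualDataSat κ γ M (padicCoeffIntegers S) V j S₀ ε) [Module.Finite (IwasawaAlgebra p) D.X] (hX : Module.IsTorsion (IwasawaAlgebra p) D.X)
    {γv : absoluteGaloisGroup (v.adicCompletion K)}
    (𝓛 : letI := localAction (closureEmb (K := K) (v.adicCompletion K)) M
      haveI := smulCommClass_localAction (R := padicCoeffIntegers S) M v
      LayerPairing S M γv κ γ⁻¹ θ' P)
    (hvS₀ : v ∉ S₀) (hvP : v ∈ P) (hP : P.Finite) (hPS₀ : ∀ w ∈ P, w ∉ S₀ → w = v) (hNP : ∀ n, ramificationSubgroup K P ≤ κ.layerSubgroup n)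
    (hperf : ∀ k : ℕ, Bijective fun a : ↥(torsionPow M p k) ↦ (PG k).toLin.flip a) (I : CycIwasawaCohomologyDataO S κ γ⁻¹ θ' P 1)
    (hStr : ∀ (n k : ℕ) (f : IwasawaAlgebraO S) (y : cycLayerCohO S κ θ' P n k 1), y ∈ strictLevel S κ θ' P S₀ n k →
      (letI := cycLayerModuleO S κ γ⁻¹ θ' P (show 1 ≤ 2 by norm_num) n k; f • y) ∈ strictLevel S κ θ' P S₀ n k)
    (hfin : letI : ∀ w : HeightOneSpectrum (𝓞 K), Module (IwasawaAlgebra p) (semilocIwasawaCohomologyDataO S κ γ⁻¹ θ' P w 1).H :=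
        fun w ↦ (semilocIwasawaCohomologyDataO S κ γ⁻¹ θ' P w 1).moduleIwasawa
      Module.Finite (IwasawaAlgebra p) (∀ w : S₀, (semilocIwasawaCohomologyDataO S κ γ⁻¹ θ' P w 1).H))
    (htors : letI : ∀ w : HeightOneSpectrum (𝓞 K), Module (IwasawaAlgebra p) (semilocIwasawaCohomologyDataO S κ γ⁻¹ θ' P w 1).H :=
        fun w ↦ (semilocIwasawaCohomologyDataO S κ γ⁻¹ θ' P w 1).moduleIwasawa
      Module.IsTorsion (IwasawaAlgebra p) (∀ w : S₀, (semilocIwasawaCohomologyDataO S κ γ⁻¹ θ' P w 1).H)) :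
    letI := localAction (closureEmb (K := K) (v.adicCompletion K)) M
    letI := I.moduleIwasawa
    letI : Algebra (IwasawaAlgebra p) (IwasawaAlgebraO S) := (iwasawaToIwasawaO S).toAlgebra
    haveI := I.isScalarTower_moduleIwasawa
    letI : ∀ w : HeightOneSpectrum (𝓞 K), Module (IwasawaAlgebra p) (semilocIwasawaCohomologyDataO S κ γ⁻¹ θ' P w 1).H :=
      fun w ↦ (semilocIwasawaCohomologyDataO S κ γ⁻¹ θ' P w 1).moduleIwasawa
    haveI : ∀ w : HeightOneSpectrum (𝓞 K), IsScalarTower (IwasawaAlgebra p) (IwasawaAlgebraO S) (semilocIwasawaCohomologyDataO S κ γ⁻¹ θ' P w 1).H :=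
      fun w ↦ (semilocIwasawaCohomologyDataO S κ γ⁻¹ θ' P w 1).isScalarTower_moduleIwasawa
    letI := locImageDualModule κ (padicCoeffIntegers S) V j S₀ ε v (fun _ _ ↦ rfl) hvp S₁ hns hM hstabK hγ
    lambdaInvariant p (unramifiedFamilies S κ γ⁻¹ θ' P S₀) ≤
      lambdaInvariant p (locImageQuot κ M (padicCoeffIntegers S) V j S₀ ε v (fun _ _ ↦ rfl) hvp S₁ →+ AddCircle (1 : ℚ)) +
        lambdaInvariant p (I.H ⧸ LinearMap.range (Submodule.subtype (strictCarrier I (strictLevel S κ θ' P S₀) hStr))) := by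
  letI := localAction (closureEmb (K := K) (v.adicCompletion K)) M
  letI := I.moduleIwasawa
  letI : Algebra (IwasawaAlgebra p) (IwasawaAlgebraO S) := (iwasawaToIwasawaO S).toAlgebra
  haveI := I.isScalarTower_moduleIwasawa
  letI : ∀ w : HeightOneSpectrum (𝓞 K), Module (IwasawaAlgebra p) (semilocIwasawaCohomologyDataO S κ γ⁻¹ θ' P w 1).H :=
    fun w ↦ (semilocIwasawaCohomologyDataO S κ γ⁻¹ θ' P w 1).moduleIwasawa
  haveI : ∀ w : HeightOneSpectrum (𝓞 K), IsScalarTower (IwasawaAlgebra p) (IwasawaAlgebraO S) (semilocIwasawaCohomologyDataO S κ γ⁻¹ θ' P w 1).H :=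
    fun w ↦ (semilocIwasawaCohomologyDataO S κ γ⁻¹ θ' P w 1).isScalarTower_moduleIwasawa
  letI := locImageDualModule κ (padicCoeffIntegers S) V j S₀ ε v (fun _ _ ↦ rfl) hvp S₁ hns hM hstabK hγ
  haveI := moduleFinite_locImageDual D (fun _ _ ↦ rfl) hvp S₁ hns hM hstabK hγ
  exact lambdaInvariant_le_add_of_ker_subset_range_semilocMapPi hNP S₀ I (fun w ↦ semilocIwasawaCohomologyDataO S κ γ⁻¹ θ' P w 1) hStr hfin htors
    (unramifiedFamilies S κ γ⁻¹ θ' P S₀) (isTorsion_locImageDual D (fun _ _ ↦ rfl) hvp S₁ hns hM hstabK hγ hX)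
    (phiOn S κ γ θ' P v M hstabK PG hPred hPsc hM V j S₀ hS₀ ε hvp hns hγ S₁ hS₀S₁ (unramifiedFamilies S κ γ⁻¹ θ' P S₀))
    fun x hx ↦ mem_range_semilocMapPi_of_phiLocImage_eq_zero S κ γ θ' P S₀ v M hstabK PG hPred hM V j hS₀ ε hvp hpv S₁ hS₀S₁ 𝓛 hvS₀ hvP hP hPS₀ hNP hperf I
      (x : ∀ w : S₀, (semilocIwasawaCohomologyDataO S κ γ⁻¹ θ' P w 1).H) x.2 hx

end Assembly

end Summit.BirchSwinnertonDyer.BirchSwinnertonDyer.Theorems.SmallImageRttD2Seq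

end
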